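import Summits.QuantumFields.YangMills.Theorems.UnitScaleTiltHistoryTailBoundedHeightLocal
import Summits.QuantumFields.YangMills.Theorems.CovariantDischargeSandwichCover

/-!
# Route `CovariantDischarge` rev 1 — BC5 RUNG of the deciding crux `SandwichFractionalWindowTailL` (stmt-QuantumFields-24186):
# the LADDER-UNIFORM SANDWICH WINDOW TAIL AT BOUNDED DEPTH `j ≤ j₀`

Tribunal round 2 (judge J, 2026-08-29T07:18Z) recorded the route's T3 witness as PLAN-ONLY («bounded-depth sandwich rung by locality in
scratch; land it»); this file lands it.  For every `L, j₀, b₀ > 0, p₀ > 2, Λ > 1` there are `γ₁ = 1`, `C`, `c > 0`, `N = 5` with, UNIFORMLY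
over the ladder base `b ≥ b₀`, for every `F` (`F.L = L`), `0 < γ ≤ 1`, every run `K`, free top `n`, constrained height `j ≤ j₀`, `j + n ≤ K`
and plaquette `p`: the Gibbs mass of the SANDWICH event {finer heights θ_b-small ∧ coarser heights `j' ∈ [j, K−n]` θ_{Λb}-small ∧
`θ_b(K−j) ≤ dist1(Ū^j(∂p))`} is `≤ C·β_{K−j}^5·exp(−c·p_{b₀}(g_{K−j})²)`.

WHY IT IS A WITNESS OF WEAKNESS AND NOT OF S: it is the deciding crux restricted to bounded depth (the crux asks for all heights in the
coupled range `N₁·j + n ≤ K`, i.e. depth growing linearly with `K`); it exercises the route's lever only in its cheapest form — monotonicity of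
Bałaban's thresholds in the profile constant (`θ_{b₀} ≤ θ_b`, so the sandwich event at base `b` lies in the plain per-plaquette tail at base
`b₀`) and the tree's bounded-height per-plaquette tail `HistoryTailBoundedHeightLocal.perPlaquette_boundedHeight_uniform` (locality of
`j₀`-fold block averaging + the finest-height tail) — and neither the rung `YM3TorusSU2` nor the crux `UnitScaleTilt.HistoryTailL` is known
at bounded depth (their content is the deep heights).  Nothing here is proved about the Yang–Mills mass gap; rung R3 is a record rung.

References: T. Bałaban, CMP 102 (1985) 255–275 [Balaban1985UV3] ((7) p.257, (71) p.273); T. Bałaban, CMP 98 (1985) 17–51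
[Balaban1985Averaging] (Prop. 1, (51) p.26).
-/

noncomputable section

open MeasureTheory
open Literature.MathematicalPhysics.QuantumFieldTheory.Balaban1983to89
open Literature.MathematicalPhysics.QuantumFieldTheory.Balaban1983to89.T3ContinuumYM3Torus

namespace Summit.QuantumFields.YangMills.Theorems

namespace CovariantDischargeSandwichBoundedDepth

/-- `θBal` is monotone in the profile constant `b` (linear: `θBal_const_mul'`; nonnegative for `0 < γ ≤ 1`, `1 ≤ L`). [cite: Balaban1985UV3, (7) p.257] -/
theorem θBal_le_θBal_of_le {L : ℕ} (hL : 1 ≤ L) {γ : ℝ} (hγ : 0 < γ) (hγ1 : γ ≤ 1) {b₀ b : ℝ} (hb₀ : 0 < b₀) (hb : b₀ ≤ b)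
    (p₀ : ℝ) (i : ℕ) : T3UnitScaleTilt.θBal L γ b₀ p₀ i ≤ T3UnitScaleTilt.θBal L γ b p₀ i := by
  have hL0 : (0 : ℝ) < L := by exact_mod_cast (Nat.one_pos.trans_le hL)
  have hLi : (0 : ℝ) < ((L : ℝ)⁻¹) ^ i := pow_pos (inv_pos.mpr hL0) i
  have hg0 : 0 < Real.sqrt (γ * ((L : ℝ)⁻¹) ^ i) := Real.sqrt_pos.mpr (mul_pos hγ hLi)
  have hg1 : Real.sqrt (γ * ((L : ℝ)⁻¹) ^ i) ≤ 1 := by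
    rw [Real.sqrt_le_one]
    have h1 : ((L : ℝ)⁻¹) ^ i ≤ 1 :=
      pow_le_one₀ (inv_nonneg.mpr hL0.le) (inv_le_one_of_one_le₀ (by exact_mod_cast hL))
    calc γ * ((L : ℝ)⁻¹) ^ i ≤ 1 * 1 := mul_le_mul hγ1 h1 hLi.le zero_le_one
      _ = 1 := one_mul 1
  have hθ0 : 0 ≤ T3UnitScaleTilt.θBal L γ b₀ p₀ i := by
    unfold T3UnitScaleTilt.θBal
    exact mul_nonneg (Real.sqrt_nonneg _) (B10.pFun_nonneg b₀ p₀ _ hb₀.le hg0 hg1)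
  have hbb : b = (b / b₀) * b₀ := by field_simp
  have hr : 1 ≤ b / b₀ := by rwa [le_div_iff₀ hb₀, one_mul]
  calc T3UnitScaleTilt.θBal L γ b₀ p₀ i = 1 * T3UnitScaleTilt.θBal L γ b₀ p₀ i := (one_mul _).symm
    _ ≤ (b / b₀) * T3UnitScaleTilt.θBal L γ b₀ p₀ i := mul_le_mul_of_nonneg_right hr hθ0
    _ = T3UnitScaleTilt.θBal L γ ((b / b₀) * b₀) p₀ i :=
        (Summit.QuantumFields.YangMills.Theorems.SandwichDischargeDoor.θBal_const_mul' L γ (b / b₀) b₀ p₀ i).symm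
    _ = T3UnitScaleTilt.θBal L γ b p₀ i := by rw [← hbb]

/-- **BC5 RUNG of the deciding crux `SandwichFractionalWindowTailL` (tribunal T3: «land it»).** Bounded depth `j ≤ j₀`, ladder-uniform: the sandwich event at base `b ≥ b₀` lies in the plain tail
`{θ(b₀)(K−j) ≤ dist1(Ū^j(∂p))}`, bounded profile-uniformly by `HistoryTailBoundedHeightLocal.perPlaquette_boundedHeight_uniform L j₀`
(`γ₁ = 1`, `N = 5`). [cite: Balaban1985UV3, (7) p.257 and (71) p.273; Balaban1985Averaging, Prop. 1 (51) p.26] -/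
theorem sandwichFractionalWindowTail_boundedDepth : ∀ (L j₀ : ℕ) (b₀ p₀ Λ : ℝ), 0 < b₀ → 2 < p₀ → 1 < Λ →
    ∃ (γ₁ C c : ℝ) (N : ℕ), 0 < γ₁ ∧ γ₁ ≤ 1 ∧ 0 < c ∧ ∀ (F : T3Family) (γ : ℝ), F.L = L → 0 < γ → γ ≤ γ₁ →
      ∀ (b : ℝ), b₀ ≤ b → ∀ (K n j : ℕ), j ≤ j₀ → j + n ≤ K → ∀ p : Plaq (F.P K) j,
        (T3UnitScaleTilt.gibbsK F T3UnitLawDensityEML.ℰp γ K).real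
          {U | (∀ k, k < j → PlaqSmall (T3UnitScaleTilt.θBal F.L γ b p₀ (K - k))
                (Averaging.iter (fun i => BlockAveraging.blockAvg (P := F.P K) (j := i) T3UnitLawDensityEML.ℰp) k U)) ∧
              (∀ j', j ≤ j' → j' + n ≤ K → PlaqSmall (T3UnitScaleTilt.θBal F.L γ (Λ * b) p₀ (K - j'))
                (Averaging.iter (fun i => BlockAveraging.blockAvg (P := F.P K) (j := i) T3UnitLawDensityEML.ℰp) j' U)) ∧
              T3UnitScaleTilt.θBal F.L γ b p₀ (K - j) ≤ GaugeGroup.dist1 (GaugeField.plaqHol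
                (Averaging.iter (fun i => BlockAveraging.blockAvg (P := F.P K) (j := i) T3UnitLawDensityEML.ℰp) j U) p)}
        ≤ C * ((γ * ((F.L : ℝ)⁻¹) ^ (K - j))⁻¹) ^ N *
            Real.exp (-(c * B10.pFun b₀ p₀ (Real.sqrt (γ * ((F.L : ℝ)⁻¹) ^ (K - j))) ^ 2)) := by
  intro L j₀ b₀ p₀ Λ hb₀ _hp₀ _hΛ
  obtain ⟨C, c, _hC, hc, h⟩ :=
    Summit.QuantumFields.YangMills.Theorems.HistoryTailBoundedHeightLocal.perPlaquette_boundedHeight_uniform L j₀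
  refine ⟨1, C, c, 5, one_pos, le_rfl, hc, fun F γ hFL hγ hγ1 b hb K n j hj0 hjK p => ?_⟩
  haveI := T3UnitScaleTilt.isProbabilityMeasure_gibbsK F T3UnitLawDensityEML.ℰp hγ.le K
  have hjK' : j ≤ K := le_trans (Nat.le_add_right j n) hjK
  have hmain := h F hFL γ hγ hγ1 b₀ hb₀.le p₀ K j hjK' hj0 p
  refine le_trans (measureReal_mono (fun U hU => ?_) (measure_ne_top _ _)) hmain
  have hL : 1 ≤ F.L := F.hL.2.le
  exact (θBal_le_θBal_of_le hL hγ hγ1 hb₀ hb p₀ (K - j)).trans hU.2.2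

end CovariantDischargeSandwichBoundedDepth

end Summit.QuantumFields.YangMills.Theorems

end
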